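import Literature.NumberTheory.EllipticCurves.EisensteinNewformLevelRaisingInertiaLocalGlobalProofs
import HarnessLib

/-!
# Hida 2000, Thm. 3.26 (3)(a) — Part I: the automorphic residual of the local–global road is
# one `L`-factor (`L(s, π_ℓ) ≠ 1`), not a local Langlands computation

Topic `Literature/NumberTheory/EllipticCurves`; sibling proof file of
`EisensteinNewformLevelRaising` (the named fact
`Literature.NumberTheory.EllipticCurves.Hida2000_thm326_inertia_of_level`),
`EisensteinNewformLevelRaisingInertiaProofs` (Parts A–G) and
`EisensteinNewformLevelRaisingInertiaLocalGlobalProofs` (Part H).  THEOREMS ONLY (no definition,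
no named fact; D-0026).

Part H (`Hida2000Thm326.inertia_of_level_of_localGlobal`) closed Hida's (3)(a) modulo the tree's
Carayol carrier `Automorphic.galoisRep_GL2_totallyReal_localGlobal` (`hX`) and one hypothesis
`hrec` quantified over every local Langlands datum `d` of `ℚ_ℓ`: "`tr W(u) = 1 + det W(u)` on
inertia for every Frobenius-semisimple `W ∈ d.recGL 2 ⟦π_ℓ⟧`" — the conjunction of (a) the shape
`π(μ₁, μ₂)`, `μ₁` unramified, of the local component `π_ℓ` (Casselman 1973) and (b) the VALUE of
every local Langlands correspondence on principal series (Bushnell–Henniart 2006, §33).  This file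
removes (b), and with it every reference to a local Langlands correspondence, from the residual:
the datum `d` bundled in the fact is itself a local Langlands correspondence
(`LocalLanglandsDatum.isLocalLanglands`, the accepted six-clause `IsLocalLanglandsGL`), and two of
its clauses — (iii-L) `lFactor_pairs` (JPSS `L`-factors of pairs are Euler factors of
`rec π ⊗ rec π'`) and (ii) `gl_one` (`rec₁` of the trivial character is the trivial
one-dimensional Weil–Deligne representation) — turn the purely AUTOMORPHIC statement

  (L)  `L(s, π_ℓ × 1) ≠ 1`: the local component `π_ℓ` at `ℓ ∣ N`, `v_ℓ(N) = v_ℓ(cond χ)`, of a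
       cuspidal `π` of `GL₂(𝔸_ℚ)` with the newform's weight-`k` infinity type and Satake
       parameters off `N` has a non-trivial Jacquet–Piatetski-Shapiro–Shalika `L`-factor against
       the trivial representation of `GL₁(ℚ_ℓ)` (`HasRSLFactor … P` with `P ≠ 1`, for some
       non-trivial continuous `ψ` and some invariant Radon measure on `GL₁(ℚ_ℓ) ⧸ U₁`)

into `hrec`.  (L) is classical and `d`-free: by Casselman (1973, Thm. 1) `π_ℓ = π(μ₁, μ₂)` with
`μ₁` unramified when the conductor of `π_ℓ` equals that of its central character, and
`L(s, π(μ₁, μ₂)) = L(s, μ₁) L(s, μ₂) = (1 - μ₁(ϖ) q^{-s})⁻¹` (Jacquet–Langlands 1970, Prop. 3.5;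
the `GL₂ × GL₁` integrals of JPSS 1983, Thm. 2.7, are those of Jacquet–Langlands, ibid. §3);
globally it is the non-vanishing `a_ℓ(g) ≠ 0` of the `ℓ`-th eigenvalue (Li 1975, Thm. 3 (ii); the
tree's `coeff_ne_zero_of_padicValNat_eq`) read through `L(s, π_g) = ∏_p L_p` (Gelbart 1975,
Thm. 6.16).  The tree does not yet compute `HasRSLFactor` for any ramified representation, so (L)
stays a hypothesis here.

* **I0. Weil–Deligne linear algebra.**  `trace_eq_one_add_det_of_inertiaInvariants_ne_bot`
  (`dim 2`: an inertia-fixed vector gives `tr = 1 + det` on inertia; from Part F1's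
  `trace_eq_one_add_det_of_mulVec_eq`); `eulerFactor_eq_one_of_inertiaInvariantsKerN_eq_bot` and
  its contrapositive (`det(1 - TΦ | 0) = 1`); `inertiaInvariantsKerN_ne_bot_of_equiv` (transport
  of `(ker N)^{I} ≠ 0` along an isomorphism of Weil–Deligne representations);
  `inertiaInvariantsKerN_ne_bot_of_tprod_trivial` (`(ker N)^I` of `A ⊗ 1` and of `A`, for a
  one-dimensional partner with trivial action and `N = 0`).
* **I1. Four sockets on the local–global road**, each `hX ∧ (hypothesis) → Hida (3)(a)`:
  `inertia_of_level_of_localGlobal_of_inertiaInvariants` (hypothesis: `W^{I} ≠ 0` for the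
  Frobenius-semisimple `W ∈ d.recGL 2 ⟦π_ℓ⟧`), `…_of_eulerFactor_ne_one` (hypothesis: the Euler
  factor `det(1 - TΦ | (ker N)^I)` of such `W` is `≠ 1`), and the two `d`-free ones,
  `inertia_of_level_of_localGlobal_of_hasRSLFactor` (hypothesis (L)) and
  `inertia_of_level_of_localGlobal_of_rsZeta_not_laurent` (hypothesis (L'): ONE `GL₂ × GL₁` zeta
  integral `Ψ(s; W_v, W'_{v'})` of `π_ℓ` against the trivial representation is not a Laurent
  polynomial in `q^{-s}` — the cheapest witness of (L), since by (iii-L) the Euler factor of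
  `rec π_ℓ ⊗ rec 1` is itself a JPSS `L`-polynomial of the pair); the pointwise core is
  `inertiaInvariants_ne_bot_of_eulerFactor_tprod_ne_one`.

So `Hida2000_thm326_inertia_of_level` is CLOSED MODULO {`galoisRep_GL2_totallyReal_localGlobal`
(existing named fact; Carayol 1986, Thm. (A)), (L')} — (L') being the classical computation
`Ψ(s; W_new, 1) = c · (1 - μ₁(ϖ) q^{1/2-s})⁻¹`, `c ≠ 0`, for the new vector of
`π_ℓ = π(μ₁, μ₂)`, `μ₁` unramified (Casselman 1973, Thm. 1; Jacquet–Langlands 1970, Prop. 3.5).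

## References

* H. Hida, *Modular Forms and Galois Cohomology*, CUP (2000), Thm. 3.26 (3)(a), pp. 152–153. [Hida2000]
* H. Carayol, Ann. Sci. ÉNS 19 (1986) 409–468, Thm. (A). [CarayolASENS1986]
* C. Skinner, Doc. Math. 14 (2009) 241–258, (1) p. 242. [Skinner2009]
* M. Harris, R. Taylor, Ann. of Math. Stud. 151 (2001), Thm. A (i)–(v). [HarrisTaylorAMS2001]
* H. Jacquet, I. I. Piatetski-Shapiro, J. Shalika, Amer. J. Math. 105 (1983) 367–464, Thm. 2.7.
  [JacquetPiatetskiShapiroShalika1983]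
* H. Jacquet, R. P. Langlands, *Automorphic forms on GL(2)*, LNM 114 (1970), Prop. 3.5.
* W. Casselman, *On some results of Atkin and Lehner*, Math. Ann. 201 (1973) 301–314, Thm. 1.
* W.-C. W. Li, *Newforms and functional equations*, Math. Ann. 212 (1975) 285–315, Thm. 3.
* S. Gelbart, *Automorphic forms on adele groups*, Ann. of Math. Stud. 83 (1975), Thm. 5.19, 6.16. [Gelbart1975]
* J. Tate, *Number theoretic background*, Corvallis 1979, (4.1.6). [TateCorvallis1979]
-/

noncomputable section

open scoped MatrixGroups Matrix NumberField ModularForm TensorProduct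
open Matrix CongruenceSubgroup IsDedekindDomain Field NumberField Polynomial Filter MeasureTheory

namespace Literature.NumberTheory.EllipticCurves.Hida2000Thm326

open Literature.NumberTheory.EllipticCurves.ModularForms
open Literature.NumberTheory.GaloisRepresentations Literature.NumberTheory.Automorphic
open Rat.HeightOneSpectrum UpperHalfPlane

/-! ## Part I0. Weil–Deligne linear algebra -/

section WD

variable {F : Type*} [Field F] [ValuativeRel F] [TopologicalSpace F] [IsNonarchimedeanLocalField F]

/-- **An inertia-fixed vector gives `tr = 1 + det` on inertia** (dimension `2`): if
`W^{I_F} ≠ 0` then `tr W(u) = 1 + det W(u)` for every `u ∈ I_F` (`1` is an eigenvalue of the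
`2 × 2` matrix `W(u)`; Part F1's `trace_eq_one_add_det_of_mulVec_eq`). [folklore] -/
theorem trace_eq_one_add_det_of_inertiaInvariants_ne_bot (W : WeilDeligneRep F ℂ (Fin 2 → ℂ))
    (h : W.inertiaInvariants ≠ ⊥) :
    ∀ u ∈ WeilGroup.inertia F, LinearMap.trace ℂ _ (W.ρ u) = 1 + LinearMap.det (W.ρ u) := by
  obtain ⟨v, hv, hv0⟩ := (Submodule.ne_bot_iff _).mp h
  intro u hu
  rw [linearMap_trace_eq_trace_toMatrix', ← LinearMap.det_toMatrix']
  refine trace_eq_one_add_det_of_mulVec_eq _ hv0 ?_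
  rw [LinearMap.toMatrix'_mulVec]
  exact (W.mem_inertiaInvariants_iff v).mp hv u hu

variable {C : Type*} [Field C] [CharZero C] {V : Type*} [AddCommGroup V] [Module C V]
  {V' : Type*} [AddCommGroup V'] [Module C V']

/-- **`(ker N)^{I_F} = 0` forces the Euler factor `det(1 - T·ρ(Φ) | (ker N)^{I_F})` to be `1`**
(determinant of a `0 × 0` matrix).  Tate, Corvallis 1979, (4.1.6). [cite: TateCorvallis1979, (4.1.6)] -/
theorem eulerFactor_eq_one_of_inertiaInvariantsKerN_eq_bot [FiniteDimensional C V]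
    (r : WeilDeligneRep F C V) (hn : absInertia_normal F) (hex : exists_isFrobPow (F := F))
    (h : r.inertiaInvariantsKerN = ⊥) : r.eulerFactor hn hex = 1 := by
  have h0 : Module.finrank C r.inertiaInvariantsKerN = 0 := by rw [h, finrank_bot]
  haveI : IsEmpty (Fin (Module.finrank C r.inertiaInvariantsKerN)) := by
    rw [h0]; infer_instance
  unfold WeilDeligneRep.eulerFactor
  rw [Matrix.charpolyRev]
  exact Matrix.det_isEmpty

/-- **A non-trivial Euler factor forces `(ker N)^{I_F} ≠ 0`** (contrapositive of
`eulerFactor_eq_one_of_inertiaInvariantsKerN_eq_bot`).  Tate, Corvallis 1979, (4.1.6).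
[cite: TateCorvallis1979, (4.1.6)] -/
theorem inertiaInvariantsKerN_ne_bot_of_eulerFactor_ne_one [FiniteDimensional C V]
    (r : WeilDeligneRep F C V) (hn : absInertia_normal F) (hex : exists_isFrobPow (F := F))
    (h : r.eulerFactor hn hex ≠ 1) : r.inertiaInvariantsKerN ≠ ⊥ :=
  fun hb => h (eulerFactor_eq_one_of_inertiaInvariantsKerN_eq_bot r hn hex hb)

/-- **`(ker N)^{I_F} ≠ 0` is an isomorphism invariant** of Weil–Deligne representations: an
isomorphism `e : r ≅ r'` intertwines the Weil-group actions and the monodromy operators, so it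
maps `(ker N)^{I_F}` of `r` injectively into that of `r'`.  Deligne, Antwerp II (1973), §8.4.1.
[folklore] -/
theorem inertiaInvariantsKerN_ne_bot_of_equiv {r : WeilDeligneRep F C V} {r' : WeilDeligneRep F C V'}
    (e : WeilDeligneRep.Equiv r r') (h : r.inertiaInvariantsKerN ≠ ⊥) :
    r'.inertiaInvariantsKerN ≠ ⊥ := by
  obtain ⟨v, hv, hv0⟩ := (Submodule.ne_bot_iff _).mp h
  rw [r.mem_inertiaInvariantsKerN_iff] at hv
  set φ : V ≃ₗ[C] V' := e.toRepEquiv.toLinearEquiv with hφ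
  have hφρ : ∀ (w : WeilGroup F) (x : V), φ (r.ρ w x) = r'.ρ w (φ x) := fun w x => by
    rw [hφ, Representation.Equiv.toLinearEquiv_apply, Representation.Equiv.toLinearEquiv_apply]
    exact Representation.IntertwiningMap.isIntertwining _ _ e.toRepEquiv.toIntertwiningMap w x
  have hφN : ∀ x : V, φ (r.N x) = r'.N (φ x) := fun x => LinearMap.congr_fun e.comm_N x
  refine (Submodule.ne_bot_iff _).mpr ⟨φ v, ?_, by simpa using hv0⟩
  rw [r'.mem_inertiaInvariantsKerN_iff]
  refine ⟨?_, fun u hu => ?_⟩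
  · rw [← hφN, hv.1, map_zero]
  · rw [← hφρ, hv.2 u hu]

/-- **`(ker N)^{I_F}` of `A ⊗ B` for a one-dimensional partner `B` with trivial action on inertia
and `N_B = 0`**: every element of `V ⊗ (Fin 1 → C)` is `a ⊗ b` for the basis vector `b`, and
`N_{A ⊗ B}(a ⊗ b) = N_A a ⊗ b`, `(A ⊗ B)(u)(a ⊗ b) = A(u) a ⊗ b` for `u ∈ I_F`; so
`(ker N_{A⊗B})^{I_F} ≠ 0` forces `(ker N_A)^{I_F} ≠ 0`.  Deligne, Antwerp II (1973), (8.1.2),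
§8.12. [folklore] -/
theorem inertiaInvariantsKerN_ne_bot_of_tprod_trivial (A : WeilDeligneRep F C V)
    (B : WeilDeligneRep F C (Fin 1 → C)) (hBρ : ∀ u ∈ WeilGroup.inertia F, ∀ x, B.ρ u x = x)
    (hBN : ∀ x, B.N x = 0) (h : (A.tprod B).inertiaInvariantsKerN ≠ ⊥) :
    A.inertiaInvariantsKerN ≠ ⊥ := by
  classical
  -- the basis vector `b` of `Fin 1 → C` and the retraction `Φ (y ⊗ c) = c 0 • y`
  set b : Fin 1 → C := fun _ => 1 with hb
  set ε : (Fin 1 → C) ≃ₗ[C] C := LinearEquiv.funUnique (Fin 1) C C with hε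
  set Φ : V ⊗[C] (Fin 1 → C) ≃ₗ[C] V :=
    (TensorProduct.congr (LinearEquiv.refl C V) ε).trans (TensorProduct.rid C V) with hΦ
  have hΦ_tmul : ∀ (y : V) (c : Fin 1 → C), Φ (y ⊗ₜ c) = c 0 • y := fun y c => by
    simp [hΦ, hε, TensorProduct.congr_tmul, TensorProduct.rid_tmul, LinearEquiv.funUnique_apply]
  have hΦb : ∀ y : V, Φ (y ⊗ₜ b) = y := fun y => by rw [hΦ_tmul, hb]; simp
  -- every tensor is `a ⊗ b`
  have hsurj : ∀ x : V ⊗[C] (Fin 1 → C), x = Φ x ⊗ₜ b := by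
    intro x
    induction x using TensorProduct.induction_on with
    | zero => simp
    | tmul y c =>
        rw [hΦ_tmul, TensorProduct.smul_tmul]
        congr 1
        funext i
        rw [Pi.smul_apply, hb, smul_eq_mul, mul_one, Subsingleton.elim i 0]
    | add x y hx hy => rw [map_add, TensorProduct.add_tmul, ← hx, ← hy]
  obtain ⟨x, hx, hx0⟩ := (Submodule.ne_bot_iff _).mp h
  rw [(A.tprod B).mem_inertiaInvariantsKerN_iff] at hx
  refine (Submodule.ne_bot_iff _).mpr ⟨Φ x, ?_, fun h0 => hx0 (by rw [hsurj x, h0, TensorProduct.zero_tmul])⟩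
  rw [A.mem_inertiaInvariantsKerN_iff]
  refine ⟨?_, fun u hu => ?_⟩
  · -- `N (a ⊗ b) = N_A a ⊗ b`
    have hN := hx.1
    rw [hsurj x, WeilDeligneRep.tprod_N, LinearMap.add_apply, TensorProduct.map_tmul,
      TensorProduct.map_tmul, hBN, TensorProduct.tmul_zero, add_zero, Module.End.one_apply] at hN
    rw [← hΦb (A.N (Φ x)), hN, map_zero]
  · have hρ := hx.2 u hu
    rw [hsurj x, WeilDeligneRep.tprod_ρ_apply, TensorProduct.map_tmul, hBρ u hu] at hρ
    -- hρ : A.ρ u (Φ x) ⊗ b = Φ x ⊗ b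
    rw [← hΦb (A.ρ u (Φ x)), hρ, hΦb]

end WD

/-! ## Part I1. Sockets on the local–global road -/

section LocalGlobal

open scoped Valued
open ValuativeRel

variable {N : ℕ}

/-- **Hida 2000, Thm. 3.26 (3)(a) from Carayol's compatibility (the tree's fact) plus an
inertia-fixed vector of `rec(π_ℓ)`.**  As `inertia_of_level_of_localGlobal` (Part H2), with the
local-automorphic hypothesis weakened from "`tr W(u) = 1 + det W(u)` on inertia" to
"`W^{I} ≠ 0`" for the Frobenius-semisimple `W ∈ d.recGL 2 ⟦π_ℓ⟧` (`π_ℓ` a local component at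
`ℓ ∣ N`, `v_ℓ(N) = v_ℓ(cond χ)`, of a cuspidal `π` with the newform's infinity type and Satake
parameters off `N`; `d` any local Langlands datum of `ℚ_ℓ`) — in dimension `2` the two are
equivalent given the ramified determinant, and `trace_eq_one_add_det_of_inertiaInvariants_ne_bot`
is the direction needed.  [cite: Hida2000, Thm. 3.26 (3)(a), pp. 152–153]
[cite: CarayolASENS1986, Thm. (A)] [cite: Skinner2009, (1) p. 242] -/
theorem inertia_of_level_of_localGlobal_of_inertiaInvariants
    (hX : galoisRep_GL2_totallyReal_localGlobal)
    (hInv : ∀ {N : ℕ} [NeZero N] {k : ℤ} (g : CuspForm (Gamma1 N) k), 2 ≤ k → IsNewform1 g →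
      ∀ (hcpt : isCompact_glFiniteIntegralLevel 2 ℚ) (π : CuspidalAutomorphicRepData 2 ℚ hcpt),
        π.1.HasInfinityType (fun _ =>
          ({⟨(k : ℂ) - 1, 0, ⟨k - 1, by push_cast; ring⟩⟩, ⟨0, (k : ℂ) - 1, ⟨1 - k, by push_cast; ring⟩⟩} :
            Multiset ArchWeight)) →
        (∀ ℓ : ℕ, ℓ.Prime → ¬ ℓ ∣ N →
          ∀ w : HeightOneSpectrum (𝓞 ℚ), (ℓ : 𝓞 ℚ) ∈ w.asIdeal →
            ∃ α : Multiset ℂ, π.1.HasSatakeParamAt w α ∧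
              (α.map fun a => X - C a⁻¹).prod =
                X ^ 2 - C ((qExpansion 1 ⇑g).coeff ℓ) * X +
                  C ((nebentypus g (ℓ : ZMod N) : ℂ) * (ℓ : ℂ) ^ (k - 1))) →
        ∀ ℓ : ℕ, ℓ.Prime → ℓ ∣ N → padicValNat ℓ N = padicValNat ℓ (nebentypus g).conductor →
        ∀ w : HeightOneSpectrum (𝓞 ℚ), (ℓ : 𝓞 ℚ) ∈ w.asIdeal →
        ∀ (d : LocalLanglandsDatum (w.adicCompletion ℚ))
          (πv : SmoothIrrep (GL (Fin 2) (w.adicCompletion ℚ))),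
          π.1.HasLocalComponentAt w πv.ρ →
        ∀ (W : WeilDeligneRep (w.adicCompletion ℚ) ℂ (Fin 2 → ℂ)) (hW : W.IsFrobSemisimple),
          Quotient.mk (frobSemisimpleWDSetoid (w.adicCompletion ℚ) 2) ⟨W, hW⟩ =
            d.recGL 2 (IrrClass.mk πv) →
          W.inertiaInvariants ≠ ⊥) :
    Hida2000_thm326_inertia_of_level :=
  inertia_of_level_of_localGlobal hX
    fun g hk hg hcpt π hT hSat ℓ hℓ hℓN hcond w hw d πv hπv W hW hq =>
      trace_eq_one_add_det_of_inertiaInvariants_ne_bot W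
        (hInv g hk hg hcpt π hT hSat ℓ hℓ hℓN hcond w hw d πv hπv W hW hq)

/-- **Hida 2000, Thm. 3.26 (3)(a) from Carayol's compatibility plus a non-trivial Euler factor of
`rec(π_ℓ)`**: as `inertia_of_level_of_localGlobal_of_inertiaInvariants`, with the hypothesis in
Tate's form "`det(1 - T·Φ | (ker N)^{I}) ≠ 1`" (`WeilDeligneRep.eulerFactor`, computed with the
datum's own `absInertia_normal` / `exists_isFrobPow` witnesses) for the Frobenius-semisimple
`W ∈ d.recGL 2 ⟦π_ℓ⟧` — i.e. `L(s, rec(π_ℓ)) ≠ 1`.  Tate, Corvallis 1979, (4.1.6).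
[cite: Hida2000, Thm. 3.26 (3)(a), pp. 152–153] [cite: CarayolASENS1986, Thm. (A)]
[cite: TateCorvallis1979, (4.1.6)] -/
theorem inertia_of_level_of_localGlobal_of_eulerFactor_ne_one
    (hX : galoisRep_GL2_totallyReal_localGlobal)
    (hEul : ∀ {N : ℕ} [NeZero N] {k : ℤ} (g : CuspForm (Gamma1 N) k), 2 ≤ k → IsNewform1 g →
      ∀ (hcpt : isCompact_glFiniteIntegralLevel 2 ℚ) (π : CuspidalAutomorphicRepData 2 ℚ hcpt),
        π.1.HasInfinityType (fun _ =>
          ({⟨(k : ℂ) - 1, 0, ⟨k - 1, by push_cast; ring⟩⟩, ⟨0, (k : ℂ) - 1, ⟨1 - k, by push_cast; ring⟩⟩} :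
            Multiset ArchWeight)) →
        (∀ ℓ : ℕ, ℓ.Prime → ¬ ℓ ∣ N →
          ∀ w : HeightOneSpectrum (𝓞 ℚ), (ℓ : 𝓞 ℚ) ∈ w.asIdeal →
            ∃ α : Multiset ℂ, π.1.HasSatakeParamAt w α ∧
              (α.map fun a => X - C a⁻¹).prod =
                X ^ 2 - C ((qExpansion 1 ⇑g).coeff ℓ) * X +
                  C ((nebentypus g (ℓ : ZMod N) : ℂ) * (ℓ : ℂ) ^ (k - 1))) →
        ∀ ℓ : ℕ, ℓ.Prime → ℓ ∣ N → padicValNat ℓ N = padicValNat ℓ (nebentypus g).conductor →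
        ∀ w : HeightOneSpectrum (𝓞 ℚ), (ℓ : 𝓞 ℚ) ∈ w.asIdeal →
        ∀ (d : LocalLanglandsDatum (w.adicCompletion ℚ))
          (πv : SmoothIrrep (GL (Fin 2) (w.adicCompletion ℚ))),
          π.1.HasLocalComponentAt w πv.ρ →
        ∀ (W : WeilDeligneRep (w.adicCompletion ℚ) ℂ (Fin 2 → ℂ)) (hW : W.IsFrobSemisimple),
          Quotient.mk (frobSemisimpleWDSetoid (w.adicCompletion ℚ) 2) ⟨W, hW⟩ =
            d.recGL 2 (IrrClass.mk πv) →
          W.eulerFactor d.hn d.hex ≠ 1) :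
    Hida2000_thm326_inertia_of_level :=
  inertia_of_level_of_localGlobal_of_inertiaInvariants hX
    fun g hk hg hcpt π hT hSat ℓ hℓ hℓN hcond w hw d πv hπv W hW hq hb =>
      inertiaInvariantsKerN_ne_bot_of_eulerFactor_ne_one W d.hn d.hex
        (hEul g hk hg hcpt π hT hSat ℓ hℓ hℓN hcond w hw d πv hπv W hW hq)
        (le_bot_iff.mp (hb ▸ W.inertiaInvariantsKerN_le_inertiaInvariants))

/-- **The pointwise core of the `L`-factor road**: for a local Langlands datum `d` of `F`, an
irreducible smooth `π_v` of `GL₂(F)` and ANY irreducible smooth `π'` of `GL₁(F)` with trivial action,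
if the Euler factor `det(1 - TΦ | (ker N)^I)` of `(d.recGL 2 ⟦π_v⟧).out ⊗ (d.recGL 1 ⟦π'⟧).out` is
`≠ 1`, then every Frobenius-semisimple `W` of class `d.recGL 2 ⟦π_v⟧` has `W^{I_F} ≠ 0`.
Clause (ii) `gl_one` of `d.isLocalLanglands` (Harris–Taylor 2001, Thm. A (ii): `rec₁(1 ∘ det)` is
`(1 ∘ artin, N = 0)`) makes the second factor trivial with `N = 0`
(`inertiaInvariantsKerN_ne_bot_of_tprod_trivial`), and `W ≅ (d.recGL 2 ⟦π_v⟧).out`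
(`Quotient.exact`, `inertiaInvariantsKerN_ne_bot_of_equiv`).
[cite: HarrisTaylorAMS2001, Thm. A (ii)] [cite: TateCorvallis1979, (4.1.6)] -/
theorem inertiaInvariants_ne_bot_of_eulerFactor_tprod_ne_one {F : Type} [Field F] [ValuativeRel F]
    [TopologicalSpace F] [IsNonarchimedeanLocalField F] (d : LocalLanglandsDatum F)
    (πv : SmoothIrrep (GL (Fin 2) F)) (π' : SmoothIrrep (GL (Fin 1) F))
    (hπ' : ∀ (x : GL (Fin 1) F) (v : π'.V), π'.ρ x v = v)
    (hE : (((d.recGL 2 (IrrClass.mk πv)).out.1).tprod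
      ((d.recGL 1 (IrrClass.mk π')).out.1)).eulerFactor d.hn d.hex ≠ 1)
    (W : WeilDeligneRep F ℂ (Fin 2 → ℂ)) (hW : W.IsFrobSemisimple)
    (hq : Quotient.mk (frobSemisimpleWDSetoid F 2) ⟨W, hW⟩ = d.recGL 2 (IrrClass.mk πv)) :
    W.inertiaInvariants ≠ ⊥ := by
  have hT : (((d.recGL 2 (IrrClass.mk πv)).out.1).tprod
      ((d.recGL 1 (IrrClass.mk π')).out.1)).inertiaInvariantsKerN ≠ ⊥ :=
    inertiaInvariantsKerN_ne_bot_of_eulerFactor_ne_one _ d.hn d.hex hE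
  -- (ii): `rec₁` of the trivial character is `(1 ∘ artin, N = 0)`
  have hgl : ((d.recGL 1 (IrrClass.mk π')).out.1).IsEquivalent
      (WeilDeligneRep.ofQuasiChar d.hns d.artin 1) :=
    d.isLocalLanglands.gl_one 1 π' fun x v => by simpa using hπ' x v
  obtain ⟨e⟩ := hgl
  set B₀ := (d.recGL 1 (IrrClass.mk π')).out.1 with hB₀
  set φ : (Fin 1 → ℂ) ≃ₗ[ℂ] ℂ := e.toRepEquiv.toLinearEquiv with hφ
  have hφρ : ∀ (u : WeilGroup F) (x : Fin 1 → ℂ),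
      φ (B₀.ρ u x) = (WeilDeligneRep.ofQuasiChar d.hns d.artin 1).ρ u (φ x) := fun u x => by
    rw [hφ, Representation.Equiv.toLinearEquiv_apply, Representation.Equiv.toLinearEquiv_apply]
    exact Representation.IntertwiningMap.isIntertwining _ _ e.toRepEquiv.toIntertwiningMap u x
  have hφN : ∀ x : Fin 1 → ℂ, φ (B₀.N x) = (WeilDeligneRep.ofQuasiChar d.hns d.artin 1).N (φ x) :=
    fun x => LinearMap.congr_fun e.comm_N x
  have hBρ : ∀ u ∈ WeilGroup.inertia F, ∀ x, B₀.ρ u x = x := by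
    intro u _ x
    apply φ.injective
    rw [hφρ, WeilDeligneRep.ofQuasiChar_ρ_apply]
    simp
  have hBN : ∀ x, B₀.N x = 0 := by
    intro x
    apply φ.injective
    rw [hφN, WeilDeligneRep.ofQuasiChar_N, LinearMap.zero_apply, map_zero]
  have hA : ((d.recGL 2 (IrrClass.mk πv)).out.1).inertiaInvariantsKerN ≠ ⊥ :=
    inertiaInvariantsKerN_ne_bot_of_tprod_trivial _ B₀ hBρ hBN hT
  -- `W ≅ (d.recGL 2 ⟦π_v⟧).out`
  have hWA : W.IsEquivalent ((d.recGL 2 (IrrClass.mk πv)).out.1) :=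
    Quotient.exact (hq.trans (Quotient.out_eq _).symm)
  obtain ⟨e'⟩ := hWA
  have hWk : W.inertiaInvariantsKerN ≠ ⊥ := inertiaInvariantsKerN_ne_bot_of_equiv e'.symm hA
  exact fun hb => hWk (le_bot_iff.mp (hb ▸ W.inertiaInvariantsKerN_le_inertiaInvariants))

/-- **Hida 2000, Thm. 3.26 (3)(a) from Carayol's compatibility plus ONE local `L`-factor.**
Hypotheses: `hX` — the named fact `Automorphic.galoisRep_GL2_totallyReal_localGlobal` (Carayol
1986, Thm. (A); Skinner 2009, (1)); `hL` — for every newform `g ∈ S_k(Γ₁(N))` (`k ≥ 2`), every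
cuspidal datum `π` of `GL₂(𝔸_ℚ)` with the weight-`k` infinity type and the Satake parameters of
`g` at all `ℓ' ∤ N`, every prime `ℓ ∣ N` with `v_ℓ(N) = v_ℓ(cond χ)`, `w ∣ ℓ`, and every local
component `π_w` of `π` at `w`: **`L(s, π_w × 1) ≠ 1`**, i.e. there are a non-trivial continuous
additive character `ψ` of `ℚ_w` for which `π_w` is generic, a `GL₁(ℚ_w)`-invariant Borel measure
`ν` on `GL₁(ℚ_w) ⧸ U₁` finite on compacts and positive on opens, and a polynomial `P ≠ 1` with
`HasRSLFactor π_w 1 ψ ν P` for the trivial representation `1` of `GL₁(ℚ_w)` on `ℂ`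
(Jacquet–Piatetski-Shapiro–Shalika 1983, Thm. 2.7 (i)–(ii), `GL₂ × GL₁`).  `hL` is free of any
local Langlands correspondence and of every `ℓ`-adic/`p`-adic object; it is the classical
`L(s, π_ℓ) = (1 - μ₁(ϖ)ℓ^{-s})⁻¹` for `π_ℓ = π(μ₁, μ₂)`, `μ₁` unramified (Casselman 1973, Thm. 1;
Jacquet–Langlands 1970, Prop. 3.5; `a_ℓ(g) ≠ 0`, Li 1975, Thm. 3), NOT yet a theorem of the tree.
Conclusion: the named fact `Hida2000_thm326_inertia_of_level`.
Proof: for the datum `d = llc w` of the fact, the trivial irreducible smooth `π'` of `GL₁(ℚ_w)` on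
`ℂ` (generic for every `ψ`: `U₁ = 1`) and the classes `A₀ = (d.recGL 2 ⟦π_w⟧).out`,
`B₀ = (d.recGL 1 ⟦π'⟧).out`, clause (iii-L) `lFactor_pairs` of `d.isLocalLanglands` gives
`P = det(1 - TΦ | (ker N)^I)` of `A₀ ⊗ B₀`, so `P ≠ 1` and
`inertiaInvariants_ne_bot_of_eulerFactor_tprod_ne_one` give `W^{I} ≠ 0` for every
Frobenius-semisimple `W` of class `d.recGL 2 ⟦π_w⟧`, and
`inertia_of_level_of_localGlobal_of_inertiaInvariants` (Part H2 with Part I0) concludes.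
[cite: Hida2000, Thm. 3.26 (3)(a), pp. 152–153] [cite: CarayolASENS1986, Thm. (A)]
[cite: Skinner2009, (1) p. 242] [cite: HarrisTaylorAMS2001, Thm. A (ii), (v)]
[cite: JacquetPiatetskiShapiroShalika1983, Thm. 2.7 (i)–(ii)] -/
theorem inertia_of_level_of_localGlobal_of_hasRSLFactor
    (hX : galoisRep_GL2_totallyReal_localGlobal)
    (hL : ∀ {N : ℕ} [NeZero N] {k : ℤ} (g : CuspForm (Gamma1 N) k), 2 ≤ k → IsNewform1 g →
      ∀ (hcpt : isCompact_glFiniteIntegralLevel 2 ℚ) (π : CuspidalAutomorphicRepData 2 ℚ hcpt),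
        π.1.HasInfinityType (fun _ =>
          ({⟨(k : ℂ) - 1, 0, ⟨k - 1, by push_cast; ring⟩⟩, ⟨0, (k : ℂ) - 1, ⟨1 - k, by push_cast; ring⟩⟩} :
            Multiset ArchWeight)) →
        (∀ ℓ : ℕ, ℓ.Prime → ¬ ℓ ∣ N →
          ∀ w : HeightOneSpectrum (𝓞 ℚ), (ℓ : 𝓞 ℚ) ∈ w.asIdeal →
            ∃ α : Multiset ℂ, π.1.HasSatakeParamAt w α ∧
              (α.map fun a => X - C a⁻¹).prod =
                X ^ 2 - C ((qExpansion 1 ⇑g).coeff ℓ) * X +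
                  C ((nebentypus g (ℓ : ZMod N) : ℂ) * (ℓ : ℂ) ^ (k - 1))) →
        ∀ ℓ : ℕ, ℓ.Prime → ℓ ∣ N → padicValNat ℓ N = padicValNat ℓ (nebentypus g).conductor →
        ∀ w : HeightOneSpectrum (𝓞 ℚ), (ℓ : 𝓞 ℚ) ∈ w.asIdeal →
        ∀ (πv : SmoothIrrep (GL (Fin 2) (w.adicCompletion ℚ))),
          π.1.HasLocalComponentAt w πv.ρ →
        letI : MeasurableSpace
            (GL (Fin 1) (w.adicCompletion ℚ) ⧸ upperUnitriangular (Fin 1) (w.adicCompletion ℚ)) :=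
          borel _
        ∃ (ψ : AddChar (w.adicCompletion ℚ) Circle)
          (ν : Measure
            (GL (Fin 1) (w.adicCompletion ℚ) ⧸ upperUnitriangular (Fin 1) (w.adicCompletion ℚ)))
          (P : ℂ[X]),
          ψ.IsContinuousNontrivial ∧ IsGeneric πv.ρ ψ ∧
          SMulInvariantMeasure (GL (Fin 1) (w.adicCompletion ℚ))
            (GL (Fin 1) (w.adicCompletion ℚ) ⧸ upperUnitriangular (Fin 1) (w.adicCompletion ℚ)) ν ∧
          IsFiniteMeasureOnCompacts ν ∧ ν.IsOpenPosMeasure ∧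
          HasRSLFactor Nat.one_lt_two πv.ρ (Representation.trivial ℂ (GL (Fin 1) (w.adicCompletion ℚ)) ℂ)
            ψ ν P ∧
          P ≠ 1) :
    Hida2000_thm326_inertia_of_level := by
  refine inertia_of_level_of_localGlobal_of_inertiaInvariants hX ?_
  intro N _ k g hk hg hcpt π hT hSat ℓ hℓ hℓN hcond w hw d πv hπv W hW hq
  letI : MeasurableSpace
      (GL (Fin 1) (w.adicCompletion ℚ) ⧸ upperUnitriangular (Fin 1) (w.adicCompletion ℚ)) := borel _
  haveI : BorelSpace
      (GL (Fin 1) (w.adicCompletion ℚ) ⧸ upperUnitriangular (Fin 1) (w.adicCompletion ℚ)) := ⟨rfl⟩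
  obtain ⟨ψ, ν, P, hψ, hgen, hinv, hfin, hpos, hRS, hP⟩ :=
    hL g hk hg hcpt π hT hSat ℓ hℓ hℓN hcond w hw πv hπv
  haveI := hinv
  haveI := hfin
  haveI := hpos
  -- the trivial irreducible smooth representation `1 ∘ det` of `GL₁(ℚ_w)` on `ℂ`, generic for `ψ⁻¹`
  let π' : SmoothIrrep (GL (Fin 1) (w.adicCompletion ℚ)) :=
    { V := ℂ
      ρ := Representation.trivial ℂ (GL (Fin 1) (w.adicCompletion ℚ)) ℂ
      isIrreducible := isIrreducible_of_finrank_eq_one' _ (Module.finrank_self ℂ)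
      isSmooth := fun v => by
        have h : ((Representation.trivial ℂ (GL (Fin 1) (w.adicCompletion ℚ)) ℂ).stabilizerSubgroup v :
            Set (GL (Fin 1) (w.adicCompletion ℚ))) = Set.univ := by
          ext x
          simp [Representation.mem_stabilizerSubgroup]
        rw [Representation.IsSmoothVector, h]
        exact isOpen_univ }
  have hgen' : IsGeneric π'.ρ ψ⁻¹ := by
    refine (isGeneric_iff _ _).2 ⟨LinearMap.id, (mem_whittakerFunctionals_iff _).2 fun u v => ?_,
      fun h => one_ne_zero (LinearMap.congr_fun h (1 : ℂ))⟩
    have hs : superdiagSum u = 0 := by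
      rw [superdiagSum_def]
      refine Finset.sum_eq_zero fun i _ => ?_
      have hi := i.isLt
      simp
    rw [whittakerCharFun_apply, hs, AddChar.map_zero_eq_one, Circle.coe_one, one_mul]
    rfl
  -- (iii-L): the JPSS `L`-factor is the Euler factor of `rec π_w ⊗ rec π'`
  have hLF : P = (((d.recGL 2 (IrrClass.mk πv)).out.1).tprod
      ((d.recGL 1 (IrrClass.mk π')).out.1)).eulerFactor d.hn d.hex :=
    (d.isLocalLanglands.lFactor_pairs Nat.one_pos Nat.one_lt_two πv π' ψ hψ hgen hgen' ν P).mp hRS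
  exact inertiaInvariants_ne_bot_of_eulerFactor_tprod_ne_one d πv π' (fun _ _ => rfl) (hLF ▸ hP)
    W hW hq

/-- **Hida 2000, Thm. 3.26 (3)(a) from Carayol's compatibility plus ONE zeta integral with a
pole.**  As `inertia_of_level_of_localGlobal_of_hasRSLFactor`, with the `L`-factor hypothesis
replaced by its cheapest witness: for every local component `π_w` at `ℓ ∣ N`, `v_ℓ(N) = v_ℓ(cond χ)`
(data as there), there are a non-trivial continuous `ψ` for which `π_w` is generic, an invariant
Borel measure `ν` on `GL₁(ℚ_w) ⧸ U₁` finite on compacts and positive on opens, Whittaker functionals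
`Λ` of `π_w` (for `ψ`) and `Λ'` of the trivial representation of `GL₁(ℚ_w)` on `ℂ` (for `ψ⁻¹`) and
vectors `v`, `v'` such that the `GL₂ × GL₁` zeta integral `Ψ(s; W_v, W'_{v'})`
(`rsZeta`, Jacquet–Piatetski-Shapiro–Shalika 1983, (2.4); for `m = 1` this is Jacquet–Langlands'
`∫ W(diag(a, 1)) |a|^{s - 1/2} d×a`) is NOT equal, on any right half-plane, to a Laurent polynomial
in `q^{-s}` — classically: for `π_w = π(μ₁, μ₂)`, `μ₁` unramified, the integral of the new vector
is `(1 - μ₁(ϖ) q^{1/2 - s})⁻¹` up to a non-zero constant (Casselman 1973, Thm. 1; Jacquet–Langlands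
1970, Prop. 3.5), which has a pole.  Proof: clause (iii-L) of `d.isLocalLanglands` says that the
Euler factor `P₀` of `(d.recGL 2 ⟦π_w⟧).out ⊗ (d.recGL 1 ⟦1⟧).out` IS a JPSS `L`-polynomial of the
pair (`HasRSLFactor … P₀`, from `P₀ = P₀`); were `P₀ = 1`, clause (a) of `HasRSLFactor` would make
every zeta integral a Laurent polynomial times `1/P₀(q^{-s}) = 1`; so `P₀ ≠ 1` and
`inertiaInvariants_ne_bot_of_eulerFactor_tprod_ne_one` applies.
[cite: Hida2000, Thm. 3.26 (3)(a), pp. 152–153] [cite: CarayolASENS1986, Thm. (A)]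
[cite: HarrisTaylorAMS2001, Thm. A (ii), (v)] [cite: JacquetPiatetskiShapiroShalika1983, Thm. 2.7 (i), (2.4)] -/
theorem inertia_of_level_of_localGlobal_of_rsZeta_not_laurent
    (hX : galoisRep_GL2_totallyReal_localGlobal)
    (hZ : ∀ {N : ℕ} [NeZero N] {k : ℤ} (g : CuspForm (Gamma1 N) k), 2 ≤ k → IsNewform1 g →
      ∀ (hcpt : isCompact_glFiniteIntegralLevel 2 ℚ) (π : CuspidalAutomorphicRepData 2 ℚ hcpt),
        π.1.HasInfinityType (fun _ =>
          ({⟨(k : ℂ) - 1, 0, ⟨k - 1, by push_cast; ring⟩⟩, ⟨0, (k : ℂ) - 1, ⟨1 - k, by push_cast; ring⟩⟩} :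
            Multiset ArchWeight)) →
        (∀ ℓ : ℕ, ℓ.Prime → ¬ ℓ ∣ N →
          ∀ w : HeightOneSpectrum (𝓞 ℚ), (ℓ : 𝓞 ℚ) ∈ w.asIdeal →
            ∃ α : Multiset ℂ, π.1.HasSatakeParamAt w α ∧
              (α.map fun a => X - C a⁻¹).prod =
                X ^ 2 - C ((qExpansion 1 ⇑g).coeff ℓ) * X +
                  C ((nebentypus g (ℓ : ZMod N) : ℂ) * (ℓ : ℂ) ^ (k - 1))) →
        ∀ ℓ : ℕ, ℓ.Prime → ℓ ∣ N → padicValNat ℓ N = padicValNat ℓ (nebentypus g).conductor →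
        ∀ w : HeightOneSpectrum (𝓞 ℚ), (ℓ : 𝓞 ℚ) ∈ w.asIdeal →
        ∀ (πv : SmoothIrrep (GL (Fin 2) (w.adicCompletion ℚ))),
          π.1.HasLocalComponentAt w πv.ρ →
        letI : MeasurableSpace
            (GL (Fin 1) (w.adicCompletion ℚ) ⧸ upperUnitriangular (Fin 1) (w.adicCompletion ℚ)) :=
          borel _
        ∃ (ψ : AddChar (w.adicCompletion ℚ) Circle)
          (ν : Measure
            (GL (Fin 1) (w.adicCompletion ℚ) ⧸ upperUnitriangular (Fin 1) (w.adicCompletion ℚ))),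
          ψ.IsContinuousNontrivial ∧ IsGeneric πv.ρ ψ ∧
          SMulInvariantMeasure (GL (Fin 1) (w.adicCompletion ℚ))
            (GL (Fin 1) (w.adicCompletion ℚ) ⧸ upperUnitriangular (Fin 1) (w.adicCompletion ℚ)) ν ∧
          IsFiniteMeasureOnCompacts ν ∧ ν.IsOpenPosMeasure ∧
          ∃ Λ ∈ whittakerFunctionals πv.ρ ψ,
          ∃ Λ' ∈ whittakerFunctionals (Representation.trivial ℂ (GL (Fin 1) (w.adicCompletion ℚ)) ℂ) ψ⁻¹,
          ∃ (v : πv.V) (v' : ℂ), ∀ R : RatFunc ℂ, IsLaurent R →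
            ¬ EqOnRightHalfPlane (IsNonarchimedeanLocalField.residueFieldCard (w.adicCompletion ℚ))
              (rsZeta Nat.one_lt_two ν (whittakerModel πv.ρ Λ v)
                (whittakerModel (Representation.trivial ℂ (GL (Fin 1) (w.adicCompletion ℚ)) ℂ) Λ' v'))
              R) :
    Hida2000_thm326_inertia_of_level := by
  refine inertia_of_level_of_localGlobal_of_inertiaInvariants hX ?_
  intro N _ k g hk hg hcpt π hT hSat ℓ hℓ hℓN hcond w hw d πv hπv W hW hq
  letI : MeasurableSpace
      (GL (Fin 1) (w.adicCompletion ℚ) ⧸ upperUnitriangular (Fin 1) (w.adicCompletion ℚ)) := borel _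
  haveI : BorelSpace
      (GL (Fin 1) (w.adicCompletion ℚ) ⧸ upperUnitriangular (Fin 1) (w.adicCompletion ℚ)) := ⟨rfl⟩
  obtain ⟨ψ, ν, hψ, hgen, hinv, hfin, hpos, Λ, hΛ, Λ', hΛ', v, v', hno⟩ :=
    hZ g hk hg hcpt π hT hSat ℓ hℓ hℓN hcond w hw πv hπv
  haveI := hinv
  haveI := hfin
  haveI := hpos
  -- the trivial irreducible smooth representation `1 ∘ det` of `GL₁(ℚ_w)` on `ℂ`, generic for `ψ⁻¹`
  let π' : SmoothIrrep (GL (Fin 1) (w.adicCompletion ℚ)) :=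
    { V := ℂ
      ρ := Representation.trivial ℂ (GL (Fin 1) (w.adicCompletion ℚ)) ℂ
      isIrreducible := isIrreducible_of_finrank_eq_one' _ (Module.finrank_self ℂ)
      isSmooth := fun v => by
        have h : ((Representation.trivial ℂ (GL (Fin 1) (w.adicCompletion ℚ)) ℂ).stabilizerSubgroup v :
            Set (GL (Fin 1) (w.adicCompletion ℚ))) = Set.univ := by
          ext x
          simp [Representation.mem_stabilizerSubgroup]
        rw [Representation.IsSmoothVector, h]
        exact isOpen_univ }
  have hgen' : IsGeneric π'.ρ ψ⁻¹ := by
    refine (isGeneric_iff _ _).2 ⟨LinearMap.id, (mem_whittakerFunctionals_iff _).2 fun u v => ?_,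
      fun h => one_ne_zero (LinearMap.congr_fun h (1 : ℂ))⟩
    have hs : superdiagSum u = 0 := by
      rw [superdiagSum_def]
      refine Finset.sum_eq_zero fun i _ => ?_
      have hi := i.isLt
      simp
    rw [whittakerCharFun_apply, hs, AddChar.map_zero_eq_one, Circle.coe_one, one_mul]
    rfl
  -- (iii-L) at `P₀ :=` the Euler factor itself: the Euler factor IS an `L`-polynomial of the pair
  set P₀ : ℂ[X] := (((d.recGL 2 (IrrClass.mk πv)).out.1).tprod
      ((d.recGL 1 (IrrClass.mk π')).out.1)).eulerFactor d.hn d.hex with hP₀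
  have hRS₀ : HasRSLFactor Nat.one_lt_two πv.ρ π'.ρ ψ ν P₀ :=
    (d.isLocalLanglands.lFactor_pairs Nat.one_pos Nat.one_lt_two πv π' ψ hψ hgen hgen' ν P₀).mpr hP₀
  have hE : P₀ ≠ 1 := by
    intro h1
    obtain ⟨-, ha, -⟩ := hRS₀
    obtain ⟨R, hR, hEq⟩ := ha Λ hΛ Λ' hΛ' v v'
    rw [h1, rsLRat, map_one, inv_one, mul_one] at hEq
    exact hno R hR hEq
  exact inertiaInvariants_ne_bot_of_eulerFactor_tprod_ne_one d πv π' (fun _ _ => rfl) (hP₀ ▸ hE)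
    W hW hq

end LocalGlobal

end Literature.NumberTheory.EllipticCurves.Hida2000Thm326

end
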